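import Summits.Ventures.PercRepro.RankLevelSetPerElemSkeleton
import Summits.Ventures.PercRepro.RankLevelSetPerElemThreeClass

/-! # RankLevelSetPerElemNullity — (★★) AT EVERY LEVEL AND MONO ON EVERY SIMPLE COLOOP-FREE MATROID OF NULLITY
AT MOST `4` (night-1 g36; dossier §48.13; on `RankLevelSetPerElemSkeleton` and `RankLevelSetPerElemThreeClass`)

When the dual `M✶` has rank `≤ 4`, every hyperplane `H = E ∖ K` of a circuit class has rank `≤ 3`, and the
up-shadow chain of the hyperplane family closes for EVERY circuit (`#K ≥ 3`, so `s + 1 ≥ 3 ≥ rk H`):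
**`perCircuit_le_of_nullity`** — the per-circuit inequality at every level `j ≥ 3` with `2j + 1 < #E`. With the
skeleton `perElemAt_of_perCircuit` and the levels `≤ 2` of g35 this is (★★) at EVERY level on every coloop-free
matroid of nullity `≤ 4` at every element in no parallel pair (**`perElemAt_of_coloopFree_of_nullity`**), hence
the full `Prop`s **`biIndepPerElem_of_simple_coloopFree_of_nullity`** and **`biIndepMono_of_simple_coloopFree_of_nullity`**
on every loopless matroid without parallel pairs and coloops with `rk M✶ ≤ 4`. Every declaration has a docstring;
imports: the cell's own modules and Mathlib only. Axioms: standard. -/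

namespace PercRepro

open Set Matroid

variable {α : Type} (M : Matroid α) [M.Finite]

/-! ## The per-circuit inequality under a nullity bound -/

/-- **THE PER-CIRCUIT INEQUALITY AT EVERY LEVEL `j ≥ 3` WHEN `rk M✶ ≤ 4`** (coloop-free `M`, `y` in no parallel
pair, `2j + 1 < #E`): every circuit of `y` has `≥ 3` elements, the hyperplane `H` has dual rank `≤ 3`, and the chain
from level `j − s` to level `h − j` closes since `s + 1 ≥ 3`. -/
theorem perCircuit_le_of_nullity (hcol : ∀ e, ¬ M.IsColoop e) {y : α} (hy : y ∈ M.E)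
    (hnp : ∀ z, z ≠ y → y ∉ M.closure {z}) (hν : M✶.eRank ≤ 4) {j : ℕ} (hj : 3 ≤ j)
    (hn : 2 * j + 1 < M.E.ncard) {Z₀ : Set α} (hZ₀ : Z₀ ∈ lowAbsorbAt M y j) :
    {Z ∈ lowAbsorbAt M y j | M.fundCircuit y Z = M.fundCircuit y Z₀}.ncard ≤
      {Q ∈ biIndep M (j + 1) | y ∈ Q ∧ ¬ M.Indep (insert y (M.E \ Q)) ∧
        M.fundCircuit y (M.E \ Q) = M.fundCircuit y Z₀}.ncard := by
  obtain ⟨hKeq, hSZ, hSE, hHE, -, -, hHy, hyH, hnl, -⟩ := circuit_dual_facts M hcol hy hZ₀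
  have h1 := members_le_fam M hy hZ₀
  have h2 := fam_le_targets M hy (by omega) hZ₀
  obtain ⟨z₀, hz₀⟩ : (M.E \ {y}).Nonempty := by
    rw [← Set.ncard_pos (M.ground_finite.subset Set.sdiff_subset), Set.ncard_sdiff_singleton_of_mem hy]
    omega
  have hz₀y : z₀ ≠ y := by simpa using hz₀.2
  have hK3 := (fundCircuit_ncard_absorb M hy hnp hz₀y hZ₀).1
  have hZE : Z₀ ⊆ M.E := hZ₀.1.1
  have hZj : Z₀.ncard = j := hZ₀.1.2.1
  set K := M.fundCircuit y Z₀ with hK'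
  set S := K \ {y} with hS
  set H := M.E \ K with hH
  have hyK : y ∈ K := M.mem_fundCircuit y Z₀
  have hKE : K ⊆ M.E := hKeq ▸ Set.insert_subset hy hSE
  have hKfin : K.Finite := M.ground_finite.subset hKE
  have hKcard : K.ncard = S.ncard + 1 := by
    rw [hS, Set.ncard_sdiff_singleton_of_mem hyK]
    have : 1 ≤ K.ncard := (Set.ncard_pos hKfin).mpr ⟨y, hyK⟩
    omega
  have hKle : K.ncard ≤ M.E.ncard := Set.ncard_le_ncard hKE M.ground_finite
  have hHcard : H.ncard + K.ncard = M.E.ncard := by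
    rw [hH, Set.ncard_sdiff hKE hKfin]; omega
  have hsj : S.ncard ≤ j := by
    rw [← hZj]; exact Set.ncard_le_ncard hSZ (M.ground_finite.subset hZE)
  have hyE' : y ∈ M✶.E := by rwa [Matroid.dual_ground]
  have hHE' : H ⊆ M✶.E := by rwa [Matroid.dual_ground]
  have hSE' : S ⊆ M✶.E := by rwa [Matroid.dual_ground]
  -- the rank of `H` in the dual is at most `3`
  have hρ : M✶.eRk H ≤ ((3 : ℕ) : ℕ∞) := by
    have h : M✶.eRk H + 1 ≤ ((3 : ℕ) : ℕ∞) + 1 := by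
      rw [eRk_add_one_eq_eRank_of_spanning_insert hyE' hyH hHy]
      exact hν
    exact (WithTop.add_le_add_iff_right (by decide)).mp h
  set f : ℕ → ℕ := fun i =>
    {X | X ⊆ H ∧ X.ncard = i ∧ M✶.Spanning (S ∪ X) ∧ M✶.Spanning (insert y (H \ X))}.ncard with hf
  have hchain : f (j - S.ncard) ≤ f (H.ncard - j) := by
    have hm : H.ncard - j = (j - S.ncard) + ((H.ncard + S.ncard) - 2 * j) := by omega
    rw [hm]
    refine le_of_chain f (c := H.ncard - 2 - (j - S.ncard)) (by omega) ?_
    intro t ht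
    have hstep := absorbFam_step (S := S) hHE' hSE' hyE' hyH hHy hnl hρ (by norm_num)
      (i := j - S.ncard + t) (by omega)
    have e1 : H.ncard - (j - S.ncard + t) - (3 - 1) = H.ncard - 2 - (j - S.ncard) - t := by omega
    rw [e1] at hstep
    exact hstep
  calc {Z ∈ lowAbsorbAt M y j | M.fundCircuit y Z = M.fundCircuit y Z₀}.ncard ≤ f (j - S.ncard) := h1
    _ ≤ f (H.ncard - j) := hchain
    _ ≤ _ := h2

/-- **(★★) AT EVERY LEVEL ON A COLOOP-FREE MATROID OF NULLITY `≤ 4` AT AN ELEMENT IN NO PARALLEL PAIR**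
(`rk M✶ ≤ 4`, `2j + 1 < #E`): the levels `≤ 2` are g35's, the levels `≥ 3` the per-circuit chain. -/
theorem perElemAt_of_coloopFree_of_nullity (hcol : ∀ e, ¬ M.IsColoop e) {y : α} (hy : y ∈ M.E)
    (hnp : ∀ z, z ≠ y → y ∉ M.closure {z}) (hν : M✶.eRank ≤ 4) {j : ℕ} (hn : 2 * j + 1 < M.E.ncard) :
    {Z ∈ biIndep M j | y ∉ Z}.ncard ≤ {Q ∈ biIndep M (j + 1) | y ∈ Q}.ncard := by
  rcases Nat.lt_or_ge j 3 with h2 | h3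
  · exact perElemAt_le_three M hy (by omega) hn
  · exact perElemAt_of_perCircuit M hy j (fun Z₀ hZ₀ => perCircuit_le_of_nullity M hcol hy hnp hν h3 hn hZ₀)

/-! ## The class theorems -/

/-- **(★★) HOLDS ON EVERY LOOPLESS MATROID WITHOUT PARALLEL PAIRS AND COLOOPS WHOSE DUAL HAS RANK `≤ 4`**
(nullity `≤ 4`). -/
theorem biIndepPerElem_of_simple_coloopFree_of_nullity (hl : ∀ e, ¬ M.IsLoop e)
    (hp : ∀ u v, ¬ ParallelPair M u v) (hcol : ∀ e, ¬ M.IsColoop e) (hν : M✶.eRank ≤ 4) :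
    BiIndepPerElem M :=
  fun y hy _ hj => perElemAt_of_coloopFree_of_nullity M hcol hy
    (fun _ hz => notMem_closure_singleton_of_no_partner M hy (hl y) (hp y) hz) hν hj

/-- **MONO HOLDS ON EVERY LOOPLESS MATROID WITHOUT PARALLEL PAIRS AND COLOOPS WHOSE DUAL HAS RANK `≤ 4`**. -/
theorem biIndepMono_of_simple_coloopFree_of_nullity (hl : ∀ e, ¬ M.IsLoop e)
    (hp : ∀ u v, ¬ ParallelPair M u v) (hcol : ∀ e, ¬ M.IsColoop e) (hν : M✶.eRank ≤ 4) :
    BiIndepMono M :=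
  biIndepMono_of_perElem M (biIndepPerElem_of_simple_coloopFree_of_nullity M hl hp hcol hν)

end PercRepro
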